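import Summits.QuantumFields.BalabanUV.T4Continuum.Spine.NE3.SupplierB8LevelSizes
import Summits.QuantumFields.BalabanUV.T4Continuum.Spine.NE3.CoarseSizesFromTowersB8
import Summits.QuantumFields.BalabanUV.T4Continuum.Spine.NE3.NormalPartB8LiftSup
import Summits.QuantumFields.BalabanUV.T4Continuum.Spine.NE3.QbarTowerB8
import Summits.QuantumFields.BalabanUV.T4Continuum.Support.NE7InteriorMinimiserDocking
import Summits.QuantumFields.BalabanUV.T4Continuum.Spine.NE3.SupplierB8SfClassPrep
import Summits.QuantumFields.BalabanUV.T4Continuum.Spine.NE3.TangentProjectionSlicB8Class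
import Summits.QuantumFields.BalabanUV.T4Continuum.Support.NE3EnergyRateWSupOfEndpointChart
import Summits.QuantumFields.BalabanUV.T4Continuum.Support.BlockAverageCurrent
import HarnessLib

/-!
# T⁴ programme, node NE3 — census R26′, step 2d-δ (1∕2): THE SUPPLIER OVER `sfClass` WITHOUT THE (Π-REG) MAJORANT

Cell `pub-balaban-gaps` (track G2, seat `ne3`; writer prover-pub-balaban-gaps-ne3-g4-0, 2026-08-23), census `run/shared/lean/pub/pub-balaban-gaps/ne/NE3.md` §4 R26′ ∕ §10 F8.
= `SupplierB8SfClass.decomposedRepT_sfClass_of_landauRepB8Avg` (p352971 ✓) with the per-pair input `LocalSupMajorant L N (j+1) Z m Ĉ`, `m ≤ s₁ξ` (B11 Thm 1∕Prop 2 regularity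
TYPE, asserted for nothing) DELETED: the two summed coarse sizes of `φ = QbarIter L (j+1) W Z` come from the remainder towers (`CoarseSizesFromTowersB8.coarseSizes_of_towers` over
`RemainderTowerB8`∕`RemainderL1FinalB8` — NO regularity of `Z`) and feed `SupplierB8LevelSizes.decomposedRepT_slicB8_of_landauRepB8Avg_sizes`; the global sup `‖φ‖ ≤ C₂s₁²` from
`QbarTowerB8.norm_adField_QbarIter_le` + level-`(j+1)` unitarity (class); the ℓ¹ tower's level-sum line from `NE7InteriorMinimiserDocking.radSum_family_le`.  NEW UNIFORM LINES
(letters, END style): `C0·(2α₀) ≤ 1∕3`, `8α₀ ≤ c2′`, `4s₁ ≤ c₃`, `16K·s₁ ≤ √(L²∕L^d)` (`K = C₁L²√(d(4L+1)^d)`), `K₁·(8∕3)(ε∕L²) ≤ (L∕L^d)∕2` (`K₁ = 16(d+1)(d+4)L²·Csup·d(2nbRad+1)^d`),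
`(32K)²L^d ≤ P²L⁴`, `64K₁′L^d ≤ QL²` (`K₁′ = C₁L²d(4L+1)^d`), `2(c₁+c₂)P²s₁² ≤ 1∕2`; sizes with `C₂Ĉ ↦ P`, `C₂Ĉ² ↦ Q`.  Otherwise VERBATIM p352971.
CONTENT (0 sorry, no `def`): `radSum_classRadius_le`, **`decomposedRepT_sfClass_of_landauRepB8Avg_towers`**.  HONEST FRAMING: an implication on OUR objects; the F5 shape and
`LandauRepB8Avg` are OPEN for Bałaban's minimisers; NOTHING of Bałaban's is proved; **NE3 is NOT proved**; spine PROVED 0∕9; finite T⁴ rung (B)+1 — NOT continuum YM on ℝ⁴, NOT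
infinite volume, NOT mass gap, NOT `BetaPertH`, NOT Clay.  PLACEMENT: `Summits/QuantumFields/BalabanUV/T4Continuum/Spine/NE3/`; imports accepted modules only; moves nothing.
-/

set_option autoImplicit false

open scoped BigOperators Matrix.Norms.L2Operator
open NormedSpace Finset

namespace Summit.QuantumFields.BalabanUV.T4Continuum.NE3.SupplierB8SfClassSizes

open Set
open Literature.MathematicalPhysics.QuantumFieldTheory.Balaban1983to89
open B7Prop1Explicit B7Prop2Explicit B7Prop3Flat MatrixLog
open T4AveragingDeficitWall (IsSkewDir IsUnitaryCfg SmallField vary curl curlSq dirSq dirL1 fhol Ad)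
open T4AveragingDeficitWallBoundary (IsPeriodicCfg periodBox)
open AveragingDeficitPeriodicCounting (IsPeriodicDir)
open AveragingDeficitChartCalculus (cavg)
open AveragingDeficitMultiLevelPrep (cavgIter LevelSmall cavgIter_unitary_small)
open AveragingDeficitTwoLevelPrep (twoLevelSmall prop1Radius)
open BlockAveragePushDirGauge (gaugeDir)
open MinimalActionLevels (perWin)
open MinimalActionSandwich (admissible IsMinimiser)
open MinimalActionRate (Regular sfClass rescale_bavg_mem_sfClass)
open NE3EnergyShapes (IsUnitarySite IsPeriodicSite)
open NE3TangentCovariantTower (QbarIter)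
open NE3EnergyWeightedShapes (energyNormW energyNormW_nonneg)
open NE3ProductPath (pathΓ)
open NE3ProductPathChartSlice (DecomposedRepT)
open NE3ResidualSliceRep (normalPart)
open NE3QbarIterCovLiftPrep (cruxC liftC liftC_nonneg)
open NE3RightInverseSolveLetters (thetaLoc)
open SpreadLift (loopRad)
open NE3.TangentProjectionSlicB8Class (levelSmall_family_background)
open NE3.SupplierB8SfClassPrep (DecomposedRepT.mono_sizes pdev_le_of_smallField exp_mul_sub_one_le psLine_of_levelSmall liftLetters_nonneg)
open NE3EnergyRateWSupOfEndpointChart (cavg_mem_admissible_sfClass)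
open BlockAverageCurrent (smallField_gaugeAct)
open GaugeFieldPerturbation (norm_fhol_sub_one_le_of_smallField)
open NE3.PairLandauB8 (avgKernelGauges IsLandauB8 LandauRepB8)
open NE3.PairLandauB8Avg (LandauRepB8Avg slicB8)
open NE3.QbarTowerB8 (norm_adField_QbarIter_le)
open NE3.QbarDictionary (adField relPert_eq_expCfg_adField)
open AveragingDeficitTransport (norm_Ad_of_unitary)
open NE3.CoarseSizesFromTowersB8 (coarseSizes_of_towers)
open ReplicationRightInverseBound (radSum radSum_nonneg)
open BlockAverageVaryHolo (nbRad)
open NE3CovariantLineSumsError (Csup Csup_nonneg)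
open ShellMeasureAverageProp4General (C1cov)
open NE7InteriorMinimiserDocking (radSum_family_le)
open NE3.LandauProjectionSupShape (LandauCorrectionSupB8)
open NE3.NormalPartB8LiftSup (exists_landauNormalPart_lift_sup)
open NE3.SupplierB8LevelSizes (decomposedRepT_slicB8_of_landauRepB8Avg_sizes)

noncomputable section

variable {d : ℕ} {n : Type*} [Fintype n] [DecidableEq n]

/-- At the class radius `x_j = ε∕(L^{j+1})²` (`L ≥ 2`, `0 ≤ ε`, `16·C₀·ε ≤ 3`): `radSum d L j x_j ≤ (8∕3)·ε∕L²` — k-free (`NE7InteriorMinimiserDocking.radSum_family_le`; level 0 by hand).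
[folklore] -/
theorem radSum_classRadius_le {L : ℕ} (hL : 2 ≤ L) {ε : ℝ} (hε : 0 ≤ ε) (hε1 : 16 * C0 d * ε ≤ 3) :
    ∀ j : ℕ, radSum d L j (ε / ((L : ℝ) ^ (j + 1)) ^ 2) ≤ 8 / 3 * (ε / (L : ℝ) ^ 2)
  | 0 => by
      have h0 : 0 ≤ ε / (L : ℝ) ^ 2 := by positivity
      show ε / ((L : ℝ) ^ (0 + 1)) ^ 2 ≤ 8 / 3 * (ε / (L : ℝ) ^ 2)
      rw [Nat.zero_add, pow_one]
      linarith
  | j + 1 => (radSum_family_le (d := d) hL hε hε1 j).1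

/-- **THE CHART SUPPLIER ON B8's SURFACE OVER `sfClass`, CLASS DATA DISCHARGED, UNIFORM SIZES, NO (Π-REG) MAJORANT** (= `SupplierB8SfClass.decomposedRepT_sfClass_of_landauRepB8Avg`
with the per-pair majorant input deleted — the two coarse sizes of `φ` come from the remainder towers —, the [B7]-Prop-4 regime lines doubled, four new k-free uniform lines
(`16K·s₁ ≤ ρ`, `K₁·(8∕3)(ε∕L²) ≤ (L∕L^d)∕2`, `(32K)²L^d ≤ P²L⁴`, `64K₁′L^d ≤ QL²`), and the sizes with `C₂Ĉ ↦ P`, `C₂Ĉ² ↦ Q`). [folklore] -/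
theorem decomposedRepT_sfClass_of_landauRepB8Avg_towers [Nonempty n] (hd : 3 ≤ d) {L N : ℕ} [NeZero N] (hL : 2 ≤ L) (hN : 1 ≤ N)
    {ε b g : ℝ} (hb : 0 ≤ b) (hε : 0 ≤ ε) (hε1 : ε ≤ 1)
    (hbs : 512 * (d + 1) * (d + 4) * (L : ℝ) ^ 2 * b ≤ 1) (hbε' : b + 226 * (8 * (d + 1) * (d + 4)) ^ 2 * b ^ 2 ≤ ε)
    (h1 : 16 * (14464 * ((d : ℝ) + 1) ^ 2 * ((d : ℝ) + 4) ^ 2) * ε ≤ 3) (h2 : 2 * twoLevelSmall d L * ε ≤ (L : ℝ) ^ 2)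
    (hθε : cruxC d L * ε < 1) (hθlε : thetaLoc d L * ε < 1)
    (hPsε : 8 * d * (((d : ℝ) - 1) * ε) ^ 2
      + 2 * (Fintype.card n * ((4 * (d : ℝ) ^ 2 + 16 * d * (17 * (((d : ℝ) + 1) * ((d : ℝ) + 4)))) * ε) ^ 2) ≤ 1 / 2)
    -- the [B7]-Prop-4 regime
    {α₀ s₁ s₂ β : ℝ} (hα : 0 < α₀) (hα3 : C0 d * (2 * α₀) ≤ 1 / 3) (hα4 : 4 * (2 * α₀) ≤ c2' d L) (hεα : ε < α₀) (hs₁ : 0 ≤ s₁)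
    (hsmall : Real.exp (4 * (800 * ((d : ℝ) + 1) ^ 2 * ((d : ℝ) + 4)) * α₀) * (1 + 8 * (131072 * ((d : ℝ) + 1) ^ 2) * s₁) ≤ 2)
    (hc₃ : 4 * s₁ ≤ c3 d L)
    -- the remainder towers' k-free lines and the two letters `P`, `Q` of the coarse sizes
    (hK : 16 * (C1cov d * (L : ℝ) ^ 2 * Real.sqrt (d * (2 * (2 * L) + 1) ^ d)) * s₁ ≤ Real.sqrt ((L : ℝ) ^ 2 / (L : ℝ) ^ d))
    (hS1 : (16 * (d + 1) * (d + 4) * (L : ℝ) ^ 2 * Csup d L * (d * (2 * nbRad d L + 1) ^ d)) * (8 / 3 * (ε / (L : ℝ) ^ 2)) ≤ ((L : ℝ) / (L : ℝ) ^ d) / 2)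
    {P Q : ℝ} (hP0 : 0 ≤ P) (hQ0 : 0 ≤ Q)
    (hPl : (32 * (C1cov d * (L : ℝ) ^ 2 * Real.sqrt (d * (2 * (2 * L) + 1) ^ d))) ^ 2 * (L : ℝ) ^ d ≤ P ^ 2 * (L : ℝ) ^ 4)
    (hQl : 64 * (C1cov d * (L : ℝ) ^ 2 * (d * (2 * (2 * (L : ℝ)) + 1) ^ d)) * (L : ℝ) ^ d ≤ Q * (L : ℝ) ^ 2)
    -- the uniform constants of the F5 shape, the uniform currency letters and size lines
    {K₀ K₁ AN Ac ah Λ CP : ℝ} (hK₀ : 0 ≤ K₀) (hK₁ : 0 ≤ K₁) (hCP : 0 ≤ CP)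
    (hAN : (liftC d / (1 - cruxC d L * ε) + K₁) * ((8 * (131072 * ((d : ℝ) + 1) ^ 2) * Real.exp (4 * (800 * ((d : ℝ) + 1) ^ 2 * ((d : ℝ) + 4)) * α₀)) * s₁ ^ 2) ≤ AN)
    (hAc : (2 * (liftC d * (17 + 16 * (d : ℝ))) / (1 - cruxC d L * ε) + 2 * ε * K₀) * ((8 * (131072 * ((d : ℝ) + 1) ^ 2) * Real.exp (4 * (800 * ((d : ℝ) + 1) ^ 2 * ((d : ℝ) + 4)) * α₀)) * s₁ ^ 2) ≤ Ac)
    (hah : 3 * ε + 2 * Ac + 8192 * ((s₁ + AN) * AN) + 48 * s₁ ^ 2 + 1300 * ((s₁ + AN) + (1 + 2048 * (s₁ + AN)) * AN) ^ 2 ≤ ah)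
(hlines₁ : 50 * s₁ ≤ 1) (hlineJ : s₁ + 43 * AN ≤ 1) (hlineN : 1350 * AN ≤ 1) (hlineα : 20 * (s₁ + AN) ≤ 1)
    (hlineαN : 50 * ((1 + 1024 * (s₁ + AN)) * AN) ≤ 1)
    (hρ : 2 * ((2 * (liftC d / (1 - thetaLoc d L * ε)) ^ 2 + 8 * Fintype.card n * ((d : ℝ) * liftC d ^ 2 * (2 * (d : ℝ) + 8) ^ 2 / (1 - thetaLoc d L * ε) ^ 2)) + (2 * (4 * d * (liftC d * (17 + 16 * (d : ℝ))) ^ 2 / (1 - thetaLoc d L * ε) ^ 2) + 128 * Fintype.card (T4AveragingDeficitWall.Plane d) * Fintype.card n * ((d : ℝ) * liftC d ^ 2 * (2 * (d : ℝ) + 8) ^ 2 / (1 - thetaLoc d L * ε) ^ 2))) * P ^ 2 * s₁ ^ 2 ≤ 1 / 2)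
    (hlineΛ : (1 + 24 * Real.sqrt d * (Real.exp (10 * ((s₁ + AN) + (1 + 2048 * (s₁ + AN)) * AN)) - 1)) ^ 2 + 48 * d * ah ≤ Λ)
    (hlineCP : 112 * (d : ℝ) * ah * CP ≤ 1 / (2 * (Fintype.card n : ℝ)))
    -- the pair
    (j : ℕ) {V UA UB : Site d → Fin d → (Matrix n n ℂ)ˣ} (hA : IsMinimiser d (sfClass d L N ε) L N (j + 1) V UA)
    (hB : IsMinimiser d (sfClass d L N ε) L N (j + 2) V UB) (hreg : Regular d L N b g (j + 2) UB)
    {u : Site d → (Matrix n n ℂ)ˣ} {Z : Site d → Fin d → Matrix n n ℂ} (h : LandauRepB8Avg L N (j + 1) (cavg L UB) UA u Z s₁ s₂ β)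
    -- the F5 shape at the pair, with the uniform constants (for all proof arguments — they are irrelevant)
    (hF5 : ∀ (hWu : IsUnitaryCfg (cavg L UB)) (hx : 0 ≤ ε / ((L : ℝ) ^ (j + 1)) ^ 2) (hs : LevelSmall d L j (ε / ((L : ℝ) ^ (j + 1)) ^ 2))
      (hWx : SmallField (cavg L UB) (ε / ((L : ℝ) ^ (j + 1)) ^ 2))
      (hθ : cruxC d L * (((L : ℝ) ^ (j + 1)) ^ 2 * (ε / ((L : ℝ) ^ (j + 1)) ^ 2)) < 1), LandauCorrectionSupB8 hL j hWu hx hs hWx N hθ K₀ K₁) :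
    ∃ (X Nn : Site d → Fin d → Matrix n n ℂ) (α αN a : ℝ),
      DecomposedRepT (sfClass d L N ε) L N (j + 1) V UA UB u X Nn (slicB8 L N (j + 1) (cavg L UB)) α αN
        ((1 + 2048 * Real.sqrt (16 * d + 1)) * (2 * Real.sqrt ((2 * (liftC d / (1 - thetaLoc d L * ε)) ^ 2 + 8 * Fintype.card n * ((d : ℝ) * liftC d ^ 2 * (2 * (d : ℝ) + 8) ^ 2 / (1 - thetaLoc d L * ε) ^ 2)) + (2 * (4 * d * (liftC d * (17 + 16 * (d : ℝ))) ^ 2 / (1 - thetaLoc d L * ε) ^ 2) + 128 * Fintype.card (T4AveragingDeficitWall.Plane d) * Fintype.card n * ((d : ℝ) * liftC d ^ 2 * (2 * (d : ℝ) + 8) ^ 2 / (1 - thetaLoc d L * ε) ^ 2))) * P * s₁))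
        (4 * (2 * d * (liftC d * (17 + 16 * (d : ℝ))) / (1 - thetaLoc d L * ε) + 8 * Fintype.card (T4AveragingDeficitWall.Plane d) * Real.sqrt (Fintype.card n * ((d : ℝ) * liftC d ^ 2 * (2 * (d : ℝ) + 8) ^ 2 / (1 - thetaLoc d L * ε) ^ 2) * (N : ℝ) ^ d)) * Q * ah + 8192 * d * (4 * (liftC d / (1 - thetaLoc d L * ε) + 2 * Real.sqrt ((d : ℝ) * Fintype.card n * ((d : ℝ) * liftC d ^ 2 * (2 * (d : ℝ) + 8) ^ 2 / (1 - thetaLoc d L * ε) ^ 2) * (N : ℝ) ^ d)) * Q * ah))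
        (1806 * (4 * (liftC d / (1 - thetaLoc d L * ε) + 2 * Real.sqrt ((d : ℝ) * Fintype.card n * ((d : ℝ) * liftC d ^ 2 * (2 * (d : ℝ) + 8) ^ 2 / (1 - thetaLoc d L * ε) ^ 2) * (N : ℝ) ^ d)) * Q * ah))
        a ∧
      pathΓ X Nn 0 = Z ∧ α ≤ 1 / 40 ∧ αN ≤ 1 / 100 ∧
      (1 + 24 * Real.sqrt d * (Real.exp (10 * (α + αN)) - 1) * (L : ℝ) ^ (j + 1)) ^ 2 + 48 * d * a * ((L : ℝ) ^ (j + 1)) ^ 2 ≤ Λ ∧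
      112 * (d : ℝ) * a * CP * ((L : ℝ) ^ (j + 1)) ^ 2 ≤ 1 / (2 * (Fintype.card n : ℝ)) := by
  have hL1 : 1 ≤ L := by omega
  have hL0 : (0 : ℝ) < L := by exact_mod_cast (show 0 < L by omega)
  have hd1 : 1 ≤ d := by omega
  set M : ℝ := (L : ℝ) ^ (j + 1) with hM
  have hM0 : 0 < M := by rw [hM]; exact pow_pos hL0 _
  have hM2 : 2 ≤ M := by
    rw [hM]
    calc (2 : ℝ) ≤ L := by exact_mod_cast hL
      _ = (L : ℝ) ^ 1 := (pow_one _).symm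
      _ ≤ (L : ℝ) ^ (j + 1) := pow_le_pow_right₀ (by exact_mod_cast hL1) (by omega)
  have hM1 : 1 ≤ M := by linarith only [hM2]
  set x : ℝ := ε / M ^ 2 with hxdef
  have hx0 : 0 ≤ x := by rw [hxdef]; exact div_nonneg hε (sq_nonneg M)
  have hMx : M ^ 2 * x = ε := by rw [hxdef]; field_simp
  have hξ : ((L : ℝ)⁻¹) ^ (j + 1) = M⁻¹ := by rw [hM, inv_pow]
  set C₂ : ℝ := 8 * (131072 * ((d : ℝ) + 1) ^ 2) * Real.exp (4 * (800 * ((d : ℝ) + 1) ^ 2 * ((d : ℝ) + 4)) * α₀) with hC₂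
  have hC₂0 : 0 ≤ C₂ := by rw [hC₂]; positivity
  have hC00 : 0 ≤ C0 d := by unfold C0; positivity
  have hα3w : C0 d * α₀ ≤ 1 / 3 := by nlinarith only [hα3, hC00, hα]
  have hα4w : 4 * α₀ ≤ c2' d L := by linarith only [hα4, hα]
  have hc₃w : 2 * s₁ ≤ c3 d L := by linarith only [hc₃, hs₁]
  have hq : 0 < 1 - cruxC d L * ε := by linarith only [hθε]
  have hql : 0 < 1 - thetaLoc d L * ε := by linarith only [hθlε]
  have hlC := liftC_nonneg d
  -- the uniform letters are non-negative
  have h2R : (0 : ℝ) ≤ 2 := by norm_num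
  have h17 : (0 : ℝ) ≤ 17 + 16 * (d : ℝ) := by positivity
  have hCs : 0 ≤ C₂ * s₁ ^ 2 := mul_nonneg hC₂0 (sq_nonneg _)
  have hAN0 : 0 ≤ AN := le_trans (mul_nonneg (add_nonneg (div_nonneg hlC hq.le) hK₁) hCs) hAN
  have hAc0 : 0 ≤ Ac :=
    le_trans (mul_nonneg (add_nonneg (div_nonneg (mul_nonneg h2R (mul_nonneg hlC h17)) hq.le) (mul_nonneg (mul_nonneg h2R hε) hK₀)) hCs) hAc
  have hsAN : 0 ≤ s₁ + AN := add_nonneg hs₁ hAN0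
  have hah0 : 0 ≤ ah := by
    refine le_trans ?_ hah
    have t1 : 0 ≤ 8192 * ((s₁ + AN) * AN) := mul_nonneg (by norm_num) (mul_nonneg hsAN hAN0)
    have t2 : 0 ≤ 48 * s₁ ^ 2 := mul_nonneg (by norm_num) (sq_nonneg _)
    have t3 : 0 ≤ 1300 * ((s₁ + AN) + (1 + 2048 * (s₁ + AN)) * AN) ^ 2 := mul_nonneg (by norm_num) (sq_nonneg _)
    linarith only [hε, hAc0, t1, t2, t3]
  -- (0) class data at `W = cavg L U_B`
  obtain ⟨hWu, hWP, hWx⟩ : cavg L UB ∈ sfClass d L N ε (j + 1) := rescale_bavg_mem_sfClass hL1 hb hbs hbε' hreg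
  have hsj : LevelSmall d L j x := by rw [hxdef, hM]; exact levelSmall_family_background hL hε h1 h2 j
  have hWk : IsUnitaryCfg (cavgIter L (j + 1) (cavg L UB)) := (cavgIter_unitary_small hL1 j hWu hx0 hsj hWx).1
  have admW : cavg L UB ∈ admissible (sfClass d L N ε) L (j + 1) V := cavg_mem_admissible_sfClass hL1 hb hbs hbε' hB.mem hreg
  have hθ : cruxC d L * (M ^ 2 * x) < 1 := by rw [hMx]; exact hθε
  have hθl : thetaLoc d L * (M ^ 2 * x) < 1 := by rw [hMx]; exact hθlε
  have hεM : M ^ 2 * x ≤ 1 := by rw [hMx]; exact hε1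
  have h52 : pdev (cavg L UB) < α₀ * (M⁻¹) ^ 2 := by
    have h1 : pdev (cavg L UB) ≤ x := pdev_le_of_smallField hx0 hWx
    have h2 : x = ε * (M⁻¹) ^ 2 := by rw [hxdef, inv_pow, div_eq_mul_inv]
    have h3 : ε * (M⁻¹) ^ 2 < α₀ * (M⁻¹) ^ 2 := mul_lt_mul_of_pos_right hεα (by positivity)
    linarith only [h1, h2, h3]
  -- K6-Ξ's Poincaré line at the pair from the uniform ε-line
  have hPs := psLine_of_levelSmall (n := n) hd hL j hx0 (by rw [← hM]; exact hMx) hsj hPsε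
  -- (1) the global sup of the coarse datum (from (1.37) and level-`(j+1)` unitarity — no majorant)
  have hb' : 0 ≤ s₁ * ((L : ℝ)⁻¹) ^ (j + 1) := by rw [hξ]; exact mul_nonneg hs₁ (inv_nonneg.mpr hM0.le)
  have hMs : M * (s₁ * ((L : ℝ)⁻¹) ^ (j + 1)) = s₁ := by rw [hξ]; field_simp
  have hsmall' : Real.exp (4 * (800 * ((d : ℝ) + 1) ^ 2 * ((d : ℝ) + 4)) * α₀)
      * (1 + 8 * (131072 * ((d : ℝ) + 1) ^ 2) * (M * (s₁ * ((L : ℝ)⁻¹) ^ (j + 1)))) ≤ 2 := by rw [hMs]; exact hsmall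
  have hc₃'' : 2 * (M * (s₁ * ((L : ℝ)⁻¹) ^ (j + 1))) ≤ c3 d L := by rw [hMs]; exact hc₃w
  have hc₃4 : 4 * (M * (s₁ * ((L : ℝ)⁻¹) ^ (j + 1))) ≤ c3 d L := by rw [hMs]; exact hc₃
  have hK' : 16 * (C1cov d * (L : ℝ) ^ 2 * Real.sqrt (d * (2 * (2 * L) + 1) ^ d)) * M * (s₁ * ((L : ℝ)⁻¹) ^ (j + 1))
      ≤ Real.sqrt ((L : ℝ) ^ 2 / (L : ℝ) ^ d) := by rw [mul_assoc, hMs]; exact hK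
  have hdbar : B7Eq92Concrete.dbavgCovIter L (cavg L UB) (expCfg (adField (cavg L UB) Z)) (j + 1) = 1 := by
    rw [← relPert_eq_expCfg_adField]; exact h.dbar
  have hφs : ∀ (z : Site d) (κ : Fin d), ‖QbarIter L (j + 1) (cavg L UB) Z z κ‖ ≤ C₂ * s₁ ^ 2 := by
    intro z κ
    have hloc := norm_adField_QbarIter_le L hL (cavg L UB) hWu Z j hα hα3w hα4w h52 hb' h.sup hsmall' hc₃'' hdbar z κ
    unfold adField at hloc
    rw [norm_Ad_of_unitary (hWk z κ), hMs, ← hC₂] at hloc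
    exact hloc
  -- (1′) the ℓ¹ tower's level-sum line at the pair and THE TWO COARSE SIZES from the remainder towers
  have h1' : 16 * C0 d * ε ≤ 3 := by
    have hC : C0 d = 14464 * ((d : ℝ) + 1) ^ 2 * ((d : ℝ) + 4) ^ 2 := by unfold C0; ring
    rw [hC]; exact h1
  have hS1' : (16 * (d + 1) * (d + 4) * (L : ℝ) ^ 2 * Csup d L * (d * (2 * nbRad d L + 1) ^ d)) * radSum d L j x ≤ ((L : ℝ) / (L : ℝ) ^ d) / 2 := by
    refine le_trans (mul_le_mul_of_nonneg_left ?_ (by have := Csup_nonneg d L; positivity)) hS1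
    rw [hxdef, hM]; exact radSum_classRadius_le hL hε h1' j
  obtain ⟨hφ2, hφ1⟩ := coarseSizes_of_towers hL hN j hWu hWP hx0 hsj hWx hα hα3 hα4 h52 hb' h.sup h.per hsmall' hc₃4 hK' hS1' hdbar hPl hQl
  have hS0 : 0 ≤ C₂ * s₁ ^ 2 := by positivity
  -- (2) the Landau linear normal part with its letters and sup currencies
  obtain ⟨Nn, hNs, hNP, hNL, hNQ, hR1, hR2, hR3, hR4, hNsup, haN⟩ :=
    exists_landauNormalPart_lift_sup hL hN hd1 j hWu hWP hx0 hsj hWx hθ hθl hεM hPs (hF5 hWu hx0 hsj hWx hθ) h.skew h.per hS0 hφs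
  rw [hMx] at hR1 hR2 hR3 hR4 hNsup haN
  -- the per-pair currencies `αN = A_N / M`, `aN = A_c / M²`
  have hNsup' : ∀ (y : Site d) (μ : Fin d), ‖Nn y μ‖ ≤ AN / M := by
    intro y μ
    refine (hNsup y μ).trans ?_
    rw [mul_div_assoc]
    calc (liftC d / (1 - cruxC d L * ε) + K₁) * (C₂ * s₁ ^ 2 / M)
        = (liftC d / (1 - cruxC d L * ε) + K₁) * (C₂ * s₁ ^ 2) / M := by ring
      _ ≤ AN / M := div_le_div_of_nonneg_right hAN hM0.le
  have haN' : ∀ p ∈ perWin d (N * L ^ (j + 1)), ‖curl (cavg L UB) Nn p‖ ≤ Ac / M ^ 2 := by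
    intro p hp
    refine (haN p hp).trans ?_
    have e : (2 * (liftC d * (17 + 16 * (d : ℝ))) / (M ^ 2 * (1 - cruxC d L * ε)) + 2 * x * K₀) * (C₂ * s₁ ^ 2)
        = (2 * (liftC d * (17 + 16 * (d : ℝ))) / (1 - cruxC d L * ε) + 2 * ε * K₀) * (C₂ * s₁ ^ 2) / M ^ 2 := by
      rw [hxdef, div_mul_eq_div_div_swap]
      ring
    rw [e]
    exact div_le_div_of_nonneg_right hAc (by positivity)
  -- (3) the supplier's remaining lines at the pair
  have hαN0 : 0 ≤ AN / M := by positivity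
  have haN0 : 0 ≤ Ac / M ^ 2 := by positivity
  have hα₀' : s₁ * ((L : ℝ)⁻¹) ^ (j + 1) ≤ 1 / 100 := by
    rw [hξ]
    have h1 : s₁ * M⁻¹ ≤ s₁ * (1 / 2) := by
      refine mul_le_mul_of_nonneg_left ?_ hs₁
      rw [← one_div]; exact one_div_le_one_div_of_le (by norm_num) hM2
    linarith only [h1, hlines₁]
  have hαNle : AN / M ≤ 1 / 2700 := by
    have h1 : AN / M ≤ AN / 2 := div_le_div_of_nonneg_left hAN0 (by norm_num) hM2
    linarith only [h1, hlineN]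
  have hJ1 : (s₁ * ((L : ℝ)⁻¹) ^ (j + 1) + 43 * (AN / M)) * (L : ℝ) ^ (j + 1) ≤ 1 := by
    rw [hξ, ← hM]
    have e : (s₁ * M⁻¹ + 43 * (AN / M)) * M = s₁ + 43 * AN := by
      rw [add_mul, inv_mul_cancel_right₀ hM0.ne', mul_assoc, div_mul_cancel₀ AN hM0.ne']
    rw [e]; exact hlineJ
  obtain ⟨hc₁, hc₂, hc₃', hc₄⟩ := liftLetters_nonneg d n (L := L) (N := N) hql
  have h4R : (0 : ℝ) ≤ 4 := by norm_num
  -- window radii: `W` and `U_A^u = W·e^{Z}` are both in the fine class of level `j+1`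
  have hxW : ∀ p ∈ perWin d (N * L ^ (j + 1)), ‖((fhol (cavg L UB) p : (Matrix n n ℂ)ˣ) : Matrix n n ℂ) - 1‖ ≤ x :=
    fun p _ => norm_fhol_sub_one_le_of_smallField hWx p
  have hAx : SmallField (vary (cavg L UB) Z 1) x := by
    rw [← h.rep]; exact smallField_gaugeAct h.unitary hA.mem.1.2.2
  have hxA : ∀ p ∈ perWin d (N * L ^ (j + 1)), ‖((fhol (vary (cavg L UB) Z 1) p : (Matrix n n ℂ)ˣ) : Matrix n n ℂ) - 1‖ ≤ x :=
    fun p _ => norm_fhol_sub_one_le_of_smallField hAx p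
  -- (4) THE SUPPLIER
  obtain ⟨hdec, hΓ0⟩ := decomposedRepT_slicB8_of_landauRepB8Avg_sizes (𝒞 := sfClass d L N ε) hL hN j hWu hx0 hsj hWx admW h hs₁ hα₀'
    hP0 hQ0 hφ2 hφ1 hNs hNP hNL hNQ hαN0 hNsup' hαNle hJ1 haN' haN0 hc₁ hc₂ hc₃' hc₄ hR1 hR2 hR3 hR4 hρ
    hx0 hx0 hxW hxA
  -- (5) the per-pair sizes against the uniform letters
  set α₁ : ℝ := s₁ * ((L : ℝ)⁻¹) ^ (j + 1) + AN / M with hα₁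
  set αN₁ : ℝ := (1 + 2048 * (s₁ * ((L : ℝ)⁻¹) ^ (j + 1) + AN / M)) * (AN / M) with hαN₁
  set a₁ : ℝ := 2 * x + x + 2 * (Ac / M ^ 2) + 4 * (2048 * (s₁ * ((L : ℝ)⁻¹) ^ (j + 1) + AN / M) * (AN / M))
    + 48 * (s₁ * ((L : ℝ)⁻¹) ^ (j + 1)) ^ 2
    + 1300 * ((s₁ * ((L : ℝ)⁻¹) ^ (j + 1) + AN / M) + (1 + 2048 * (s₁ * ((L : ℝ)⁻¹) ^ (j + 1) + AN / M)) * (AN / M)) ^ 2 with ha₁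
  have hα₁M : α₁ * M = s₁ + AN := by
    rw [hα₁, hξ, add_mul, inv_mul_cancel_right₀ hM0.ne', div_mul_cancel₀ AN hM0.ne']
  have hα₁0 : 0 ≤ α₁ := by
    rw [hα₁, hξ]; exact add_nonneg (mul_nonneg hs₁ (inv_nonneg.mpr hM0.le)) (div_nonneg hAN0 hM0.le)
  have hα₁le : α₁ ≤ s₁ + AN := by
    have : α₁ * 1 ≤ α₁ * M := mul_le_mul_of_nonneg_left hM1 hα₁0
    rw [mul_one, hα₁M] at this; exact this
  have hα₁half : α₁ ≤ (s₁ + AN) / 2 := by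
    rw [le_div_iff₀ (by norm_num : (0:ℝ) < 2), ← hα₁M]
    exact mul_le_mul_of_nonneg_left hM2 hα₁0
  have hANM : AN / M ≤ AN / 2 := div_le_div_of_nonneg_left hAN0 (by norm_num) hM2
  -- `(α₁ + αN₁)·M ≤ B`
  set B : ℝ := (s₁ + AN) + (1 + 2048 * (s₁ + AN)) * AN with hB
  have hcoef : 1 + 2048 * α₁ ≤ 1 + 2048 * (s₁ + AN) := by linarith only [hα₁le]
  have hcoef0 : 0 ≤ 1 + 2048 * α₁ := by linarith only [hα₁0]
  have hαN₁0 : 0 ≤ αN₁ := by rw [hαN₁, ← hα₁]; exact mul_nonneg hcoef0 (div_nonneg hAN0 hM0.le)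
  have hsumM : (α₁ + αN₁) * M ≤ B := by
    have e : (α₁ + αN₁) * M = α₁ * M + (1 + 2048 * α₁) * (AN / M * M) := by rw [hαN₁, hα₁]; ring
    rw [e, hα₁M, div_mul_cancel₀ AN hM0.ne', hB]
    have := mul_le_mul_of_nonneg_right hcoef hAN0
    linarith only [this]
  -- `a₁·M² ≤ â`
  have haM : a₁ * M ^ 2 ≤ ah := by
    have e : a₁ * M ^ 2 = 3 * (M ^ 2 * x) + 2 * Ac + 8192 * ((α₁ * M) * (AN / M * M)) + 48 * (s₁ * (((L : ℝ)⁻¹) ^ (j + 1) * M)) ^ 2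
        + 1300 * ((α₁ + αN₁) * M) ^ 2 := by
      rw [ha₁, hαN₁, hα₁]; field_simp; ring
    rw [e, hMx, hα₁M, div_mul_cancel₀ AN hM0.ne', hξ, inv_mul_cancel₀ hM0.ne', mul_one]
    have hsq : ((α₁ + αN₁) * M) ^ 2 ≤ B ^ 2 :=
      pow_le_pow_left₀ (mul_nonneg (add_nonneg hα₁0 hαN₁0) hM0.le) hsumM 2
    rw [hB] at hsq
    have t := mul_le_mul_of_nonneg_left hsq (by norm_num : (0:ℝ) ≤ 1300)
    exact le_trans (add_le_add le_rfl t) hah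
  have ha₁0 : 0 ≤ a₁ := hdec.ha
  -- (6) the three sizes against the uniform ones (`ν` is already uniform)
  have hκ₁ : 4 * (2 * d * (liftC d * (17 + 16 * (d : ℝ))) / (1 - thetaLoc d L * ε)
        + 8 * Fintype.card (T4AveragingDeficitWall.Plane d)
          * Real.sqrt (Fintype.card n * ((d : ℝ) * liftC d ^ 2 * (2 * (d : ℝ) + 8) ^ 2 / (1 - thetaLoc d L * ε) ^ 2) * (N : ℝ) ^ d))
        * Q * (a₁ * ((L : ℝ) ^ (j + 1)) ^ 2)
      + 8192 * d * (4 * (liftC d / (1 - thetaLoc d L * ε)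
        + 2 * Real.sqrt ((d : ℝ) * Fintype.card n * ((d : ℝ) * liftC d ^ 2 * (2 * (d : ℝ) + 8) ^ 2 / (1 - thetaLoc d L * ε) ^ 2) * (N : ℝ) ^ d))
        * Q * (a₁ * ((L : ℝ) ^ (j + 1)) ^ 2))
      ≤ 4 * (2 * d * (liftC d * (17 + 16 * (d : ℝ))) / (1 - thetaLoc d L * ε)
        + 8 * Fintype.card (T4AveragingDeficitWall.Plane d)
          * Real.sqrt (Fintype.card n * ((d : ℝ) * liftC d ^ 2 * (2 * (d : ℝ) + 8) ^ 2 / (1 - thetaLoc d L * ε) ^ 2) * (N : ℝ) ^ d))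
        * Q * ah
      + 8192 * d * (4 * (liftC d / (1 - thetaLoc d L * ε)
        + 2 * Real.sqrt ((d : ℝ) * Fintype.card n * ((d : ℝ) * liftC d ^ 2 * (2 * (d : ℝ) + 8) ^ 2 / (1 - thetaLoc d L * ε) ^ 2) * (N : ℝ) ^ d))
        * Q * ah) := by
    rw [← hM]
    have f3 : 0 ≤ 4 * (2 * d * (liftC d * (17 + 16 * (d : ℝ))) / (1 - thetaLoc d L * ε)
        + 8 * Fintype.card (T4AveragingDeficitWall.Plane d)
          * Real.sqrt (Fintype.card n * ((d : ℝ) * liftC d ^ 2 * (2 * (d : ℝ) + 8) ^ 2 / (1 - thetaLoc d L * ε) ^ 2) * (N : ℝ) ^ d))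
        * Q := by
      have := mul_nonneg (mul_nonneg h4R hc₃') hQ0
      simpa only [mul_assoc] using this
    have f4 : 0 ≤ 4 * (liftC d / (1 - thetaLoc d L * ε)
        + 2 * Real.sqrt ((d : ℝ) * Fintype.card n * ((d : ℝ) * liftC d ^ 2 * (2 * (d : ℝ) + 8) ^ 2 / (1 - thetaLoc d L * ε) ^ 2) * (N : ℝ) ^ d))
        * Q := by
      have := mul_nonneg (mul_nonneg h4R hc₄) hQ0
      simpa only [mul_assoc] using this
    have t3 := mul_le_mul_of_nonneg_left haM f3
    have t4 := mul_le_mul_of_nonneg_left haM f4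
    have t4' := mul_le_mul_of_nonneg_left t4 (by positivity : (0 : ℝ) ≤ 8192 * d)
    linarith only [t3, t4']
  have hκ₂ : 1806 * (4 * (liftC d / (1 - thetaLoc d L * ε)
        + 2 * Real.sqrt ((d : ℝ) * Fintype.card n * ((d : ℝ) * liftC d ^ 2 * (2 * (d : ℝ) + 8) ^ 2 / (1 - thetaLoc d L * ε) ^ 2) * (N : ℝ) ^ d))
        * Q * (a₁ * ((L : ℝ) ^ (j + 1)) ^ 2))
      ≤ 1806 * (4 * (liftC d / (1 - thetaLoc d L * ε)
        + 2 * Real.sqrt ((d : ℝ) * Fintype.card n * ((d : ℝ) * liftC d ^ 2 * (2 * (d : ℝ) + 8) ^ 2 / (1 - thetaLoc d L * ε) ^ 2) * (N : ℝ) ^ d))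
        * Q * ah) := by
    rw [← hM]
    have f4 : 0 ≤ 4 * (liftC d / (1 - thetaLoc d L * ε)
        + 2 * Real.sqrt ((d : ℝ) * Fintype.card n * ((d : ℝ) * liftC d ^ 2 * (2 * (d : ℝ) + 8) ^ 2 / (1 - thetaLoc d L * ε) ^ 2) * (N : ℝ) ^ d))
        * Q := by
      have := mul_nonneg (mul_nonneg h4R hc₄) hQ0
      simpa only [mul_assoc] using this
    have t4 := mul_le_mul_of_nonneg_left haM f4
    exact mul_le_mul_of_nonneg_left t4 (by norm_num)
  have hdec' := DecomposedRepT.mono_sizes hdec le_rfl hκ₁ hκ₂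
  -- (7) the END's four per-pair lines
  refine ⟨fun y μ => Nn y μ - Z y μ, normalPart Z fun y μ => Nn y μ - Z y μ, α₁, αN₁, a₁, hdec', hΓ0, ?_, ?_, ?_, ?_⟩
  · linarith only [hα₁half, hlineα]
  · have h1 : αN₁ ≤ (1 + 2048 * ((s₁ + AN) / 2)) * (AN / 2) := by
      rw [hαN₁, ← hα₁]
      exact mul_le_mul (by linarith only [hα₁half]) hANM (div_nonneg hAN0 hM0.le) (by linarith only [hsAN])
    have h2 : (1 + 2048 * ((s₁ + AN) / 2)) * (AN / 2) = (1 + 1024 * (s₁ + AN)) * AN / 2 := by ring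
    rw [h2] at h1
    linarith only [h1, hlineαN]
  · -- (J1) with `e^{10(α+αN)}`: convexity of `exp` moves the factor `L^{j+1}` inside
    have hsum0 : 0 ≤ α₁ + αN₁ := add_nonneg hα₁0 hαN₁0
    have hB0 : 0 ≤ B := by rw [hB]; exact add_nonneg hsAN (mul_nonneg (by linarith only [hsAN]) hAN0)
    have hle : 10 * (α₁ + αN₁) ≤ M⁻¹ * (10 * B) := by
      rw [← div_eq_inv_mul, le_div_iff₀ hM0]
      have := mul_le_mul_of_nonneg_left hsumM (by norm_num : (0:ℝ) ≤ 10)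
      linarith only [this]
    have hexp : Real.exp (10 * (α₁ + αN₁)) - 1 ≤ M⁻¹ * (Real.exp (10 * B) - 1) := by
      have h1 : Real.exp (10 * (α₁ + αN₁)) ≤ Real.exp (M⁻¹ * (10 * B)) := Real.exp_le_exp.mpr hle
      have h2 := exp_mul_sub_one_le (t := M⁻¹) (y := 10 * B) (inv_nonneg.mpr hM0.le) (inv_le_one_of_one_le₀ hM1)
      linarith only [h1, h2]
    have hE0 : 0 ≤ Real.exp (10 * (α₁ + αN₁)) - 1 := by
      have : 1 ≤ Real.exp (10 * (α₁ + αN₁)) := Real.one_le_exp (mul_nonneg (by norm_num) hsum0)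
      linarith only [this]
    have hE1 : (Real.exp (10 * (α₁ + αN₁)) - 1) * M ≤ Real.exp (10 * B) - 1 := by
      have h1 := mul_le_mul_of_nonneg_right hexp hM0.le
      have e : M⁻¹ * (Real.exp (10 * B) - 1) * M = Real.exp (10 * B) - 1 := by
        rw [mul_comm, ← mul_assoc, mul_inv_cancel₀ hM0.ne', one_mul]
      rwa [e] at h1
    have hsq : (1 + 24 * Real.sqrt d * (Real.exp (10 * (α₁ + αN₁)) - 1) * M) ^ 2
        ≤ (1 + 24 * Real.sqrt d * (Real.exp (10 * B) - 1)) ^ 2 := by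
      refine pow_le_pow_left₀ (add_nonneg zero_le_one (mul_nonneg (mul_nonneg (mul_nonneg (by norm_num) (Real.sqrt_nonneg _)) hE0) hM0.le)) ?_ 2
      have := mul_le_mul_of_nonneg_left hE1 (by positivity : (0:ℝ) ≤ 24 * Real.sqrt d)
      linarith only [this]
    have ha : 48 * d * a₁ * M ^ 2 ≤ 48 * d * ah := by
      have := mul_le_mul_of_nonneg_left haM (by positivity : (0:ℝ) ≤ 48 * d)
      linarith only [this]
    rw [hB] at hsq
    linarith only [hsq, ha, hlineΛ]
  · have e : 112 * (d : ℝ) * a₁ * CP * M ^ 2 = 112 * (d : ℝ) * (a₁ * M ^ 2) * CP := by ring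
    rw [e]
    have := mul_le_mul_of_nonneg_left haM (by positivity : (0:ℝ) ≤ 112 * d)
    have := mul_le_mul_of_nonneg_right this hCP
    linarith only [this, hlineCP]

end

end Summit.QuantumFields.BalabanUV.T4Continuum.NE3.SupplierB8SfClassSizes
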